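import Literature.NumberTheory.Sieve.LargeSieveInequality
import HarnessLib

/-!
# Green–Tao (2006): from the set estimate to the `L^p` extension estimate (dyadic pigeonhole,
# duality, integration)

B. Green, T. Tao, *Restriction theory of the Selberg sieve, with applications*, JTNB **18** (2006)
[GreenTao2006Restriction], §4: the three formal steps of the proof of Propositions 4.1–4.2 that do
not depend on the sieve,

* `restriction_lq_of_set_estimate` — the dyadic decomposition deducing the `ℓ^q → L²_β`
  restriction estimate (4.1) from its set version (4.2) (GT: "(4.2), though at first sight
  weaker than (4.1), is actually equivalent to it"), for `q(1+3ε) < 2`;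
* `extension_of_restriction` — the duality `‖T‖ = ‖T*‖` giving the `L²_β → ℓ^p` extension
  estimate (4.7) on `ℤ/Nℤ` from (4.1) (`1/p + 1/q = 1`);
* `Lp_extension_of_extension` — the passage from (4.7) to the `L^p(𝕋)` estimate (4.8) by
  modulating the coefficients and integrating over `θ ∈ [0, 1]`.

All three are PROVED here for an arbitrary nonnegative weight `β` on `[1, N]`; they form the
fourth layer of the proof of the named fact
`Literature.NumberTheory.Sieve.GreenTao2006_envelopingSieve_extension`.

## References

* [GreenTao2006Restriction] Green–Tao, JTNB 18 (2006), §4: proof of Prop. 4.1 (first two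
  paragraphs), Prop. 4.2 and its proof (arXiv:math/0405581).
-/

noncomputable section

open Finset Real Complex MeasureTheory
open scoped FourierTransform ComplexConjugate

namespace Literature.NumberTheory.Sieve

namespace GreenTao2006

open LargeSieve (e e_add e_int norm_e conj_e e_zero e_eq_exp e_sub e_nat_mul e_add_int)

/-! ### Weighted Cauchy–Schwarz and Minkowski on `L²_β` -/

/-- Weighted Cauchy–Schwarz: `∑ |a_n| β_n |c_n| ≤ (∑ |a_n|² β_n)^{1/2} (∑ |c_n|² β_n)^{1/2}` for
`β ≥ 0`. [folklore] -/
theorem sum_mul_mul_le_sqrt_mul_sqrt {ι : Type*} (s : Finset ι) (a c : ι → ℂ) (β : ι → ℝ)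
    (hβ : ∀ n ∈ s, 0 ≤ β n) :
    ∑ n ∈ s, ‖a n‖ * β n * ‖c n‖ ≤
      Real.sqrt (∑ n ∈ s, ‖a n‖ ^ 2 * β n) * Real.sqrt (∑ n ∈ s, ‖c n‖ ^ 2 * β n) := by
  have h := Finset.sum_mul_sq_le_sq_mul_sq s (fun n => Real.sqrt (β n) * ‖a n‖)
    (fun n => Real.sqrt (β n) * ‖c n‖)
  have h1 : ∀ n ∈ s, Real.sqrt (β n) * ‖a n‖ * (Real.sqrt (β n) * ‖c n‖) = ‖a n‖ * β n * ‖c n‖ := by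
    intro n hn
    have := Real.mul_self_sqrt (hβ n hn)
    calc Real.sqrt (β n) * ‖a n‖ * (Real.sqrt (β n) * ‖c n‖)
        = (Real.sqrt (β n) * Real.sqrt (β n)) * ‖a n‖ * ‖c n‖ := by ring
      _ = ‖a n‖ * β n * ‖c n‖ := by rw [this]; ring
  have h2 : ∀ (d : ι → ℂ), ∀ n ∈ s, (Real.sqrt (β n) * ‖d n‖) ^ 2 = ‖d n‖ ^ 2 * β n := by
    intro d n hn
    rw [mul_pow, Real.sq_sqrt (hβ n hn)]; ring
  rw [Finset.sum_congr rfl h1, Finset.sum_congr rfl (h2 a), Finset.sum_congr rfl (h2 c)] at h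
  have hA : 0 ≤ ∑ n ∈ s, ‖a n‖ ^ 2 * β n := Finset.sum_nonneg fun n hn => by
    have := hβ n hn; positivity
  have hC : 0 ≤ ∑ n ∈ s, ‖c n‖ ^ 2 * β n := Finset.sum_nonneg fun n hn => by
    have := hβ n hn; positivity
  rw [← Real.sqrt_mul hA, Real.le_sqrt (Finset.sum_nonneg fun n hn => by
    have := hβ n hn; positivity) (mul_nonneg hA hC)]
  exact h

/-- Minkowski in `L²_β`, two functions:
`(∑ |u_n + v_n|² β_n)^{1/2} ≤ (∑ |u_n|² β_n)^{1/2} + (∑ |v_n|² β_n)^{1/2}`. [folklore] -/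
theorem sqrt_sum_norm_add_sq_mul_le {ι : Type*} (s : Finset ι) (u v : ι → ℂ) (β : ι → ℝ)
    (hβ : ∀ n ∈ s, 0 ≤ β n) :
    Real.sqrt (∑ n ∈ s, ‖u n + v n‖ ^ 2 * β n) ≤
      Real.sqrt (∑ n ∈ s, ‖u n‖ ^ 2 * β n) + Real.sqrt (∑ n ∈ s, ‖v n‖ ^ 2 * β n) := by
  set U := Real.sqrt (∑ n ∈ s, ‖u n‖ ^ 2 * β n) with hU
  set V := Real.sqrt (∑ n ∈ s, ‖v n‖ ^ 2 * β n) with hV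
  have hU0 : 0 ≤ U := Real.sqrt_nonneg _
  have hV0 : 0 ≤ V := Real.sqrt_nonneg _
  have hcs := sum_mul_mul_le_sqrt_mul_sqrt s u v β hβ
  rw [← hU, ← hV] at hcs
  have hUsq : U ^ 2 = ∑ n ∈ s, ‖u n‖ ^ 2 * β n :=
    Real.sq_sqrt (Finset.sum_nonneg fun n hn => by have := hβ n hn; positivity)
  have hVsq : V ^ 2 = ∑ n ∈ s, ‖v n‖ ^ 2 * β n :=
    Real.sq_sqrt (Finset.sum_nonneg fun n hn => by have := hβ n hn; positivity)
  refine Real.sqrt_le_iff.2 ⟨by positivity, ?_⟩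
  calc ∑ n ∈ s, ‖u n + v n‖ ^ 2 * β n ≤ ∑ n ∈ s, (‖u n‖ + ‖v n‖) ^ 2 * β n := by
        refine Finset.sum_le_sum fun n hn => mul_le_mul_of_nonneg_right ?_ (hβ n hn)
        exact pow_le_pow_left₀ (norm_nonneg _) (norm_add_le _ _) 2
    _ = ∑ n ∈ s, ‖u n‖ ^ 2 * β n + 2 * ∑ n ∈ s, ‖u n‖ * β n * ‖v n‖ +
          ∑ n ∈ s, ‖v n‖ ^ 2 * β n := by
        rw [Finset.mul_sum, ← Finset.sum_add_distrib, ← Finset.sum_add_distrib]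
        exact Finset.sum_congr rfl fun n _ => by ring
    _ ≤ U ^ 2 + 2 * (U * V) + V ^ 2 := by rw [hUsq, hVsq]; linarith
    _ = (U + V) ^ 2 := by ring

/-- Minkowski in `L²_β`, finitely many functions. [folklore] -/
theorem sqrt_sum_norm_sum_sq_mul_le {ι κ : Type*} (s : Finset ι) (J : Finset κ) (u : κ → ι → ℂ)
    (β : ι → ℝ) (hβ : ∀ n ∈ s, 0 ≤ β n) :
    Real.sqrt (∑ n ∈ s, ‖∑ j ∈ J, u j n‖ ^ 2 * β n) ≤
      ∑ j ∈ J, Real.sqrt (∑ n ∈ s, ‖u j n‖ ^ 2 * β n) := by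
  classical
  induction J using Finset.induction_on with
  | empty => simp
  | insert a J ha ih =>
    rw [Finset.sum_insert ha]
    simp_rw [Finset.sum_insert ha]
    exact (sqrt_sum_norm_add_sq_mul_le s (u a) (fun n => ∑ j ∈ J, u j n) β hβ).trans
      (add_le_add le_rfl ih)


/-! ### The dyadic decomposition: from the set estimate to the `ℓ^q` estimate -/

/-- Dyadic index: if `2^{-J} < x ≤ 1` then `2^{-(j+1)} < x ≤ 2^{-j}` for some `j < J`. [folklore] -/
theorem exists_dyadic_index {x : ℝ} {J : ℕ} (hx1 : x ≤ 1) (hxJ : (2 : ℝ)⁻¹ ^ J < x) :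
    ∃ j < J, (2 : ℝ)⁻¹ ^ (j + 1) < x ∧ x ≤ (2 : ℝ)⁻¹ ^ j := by
  classical
  set S := (range J).filter (fun j => x ≤ (2 : ℝ)⁻¹ ^ j) with hS
  have hJ : 0 < J := by
    rcases Nat.eq_zero_or_pos J with h | h
    · rw [h, pow_zero] at hxJ; linarith
    · exact h
  have h0 : 0 ∈ S := by
    rw [hS, Finset.mem_filter, Finset.mem_range, pow_zero]; exact ⟨hJ, hx1⟩
  have hne : S.Nonempty := ⟨0, h0⟩
  set j₀ := S.max' hne with hj₀
  have hj₀S : j₀ ∈ S := Finset.max'_mem S hne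
  rw [hS, Finset.mem_filter, Finset.mem_range] at hj₀S
  refine ⟨j₀, hj₀S.1, ?_, hj₀S.2⟩
  by_contra hle
  push Not at hle
  rcases Nat.lt_or_ge (j₀ + 1) J with hlt | hge
  · have hmem : j₀ + 1 ∈ S := by
      rw [hS, Finset.mem_filter, Finset.mem_range]; exact ⟨hlt, hle⟩
    have := Finset.le_max' S (j₀ + 1) hmem
    rw [← hj₀] at this
    omega
  · have hJ' : J = j₀ + 1 := by omega
    rw [hJ'] at hxJ
    linarith

/-- The powers `2^{-j}` are antitone in `j`. [folklore] -/
theorem inv_two_pow_le_of_le {i j : ℕ} (hij : i ≤ j) : (2 : ℝ)⁻¹ ^ j ≤ (2 : ℝ)⁻¹ ^ i :=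
  pow_le_pow_of_le_one (by norm_num) (by norm_num) hij

/-- **The dyadic pigeonhole** (GT, first paragraph of the proof of Prop. 4.1): the set estimate
`Φ(f) ≤ C' N |B|^{1+3ε}` for `f` supported on `B` with `|f| ≤ 1` implies the `ℓ^q` estimate
`Φ(f) ≤ C' K² N ‖f‖_{ℓ^q}²` for all `f`, where `Φ(f) = ∑_{n=1}^{N} |∑_b f(b) e(bn/N)|² β(n)`,
`q(1+3ε) < 2` and `K = 2^{c/2}/(1 - 2^{c/2-1})`, `c = q(1+3ε)`.
[cite: GreenTao2006Restriction, proof of Prop. 4.1 (deduction of (4.1) from (4.2))] -/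
theorem restriction_lq_of_set_estimate {N : ℕ} (β : ℤ → ℝ) (hβ : ∀ n ∈ Icc 1 N, 0 ≤ β n)
    {C' ε q : ℝ} (hC' : 0 < C') (hε : 0 ≤ ε) (hq1 : 1 ≤ q) (hq : q * (1 + 3 * ε) < 2)
    (hset : ∀ (B : Finset ℕ) (f : ℕ → ℂ), B ⊆ range N → (∀ b, ‖f b‖ ≤ 1) →
      (∀ b ∉ B, f b = 0) →
      ∑ n ∈ Icc 1 N, ‖∑ b ∈ range N, f b * e ((b : ℝ) * n / N)‖ ^ 2 * β n ≤
        C' * N * (B.card : ℝ) ^ (1 + 3 * ε))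
    (f : ℕ → ℂ) :
    ∑ n ∈ Icc 1 N, ‖∑ b ∈ range N, f b * e ((b : ℝ) * n / N)‖ ^ 2 * β n ≤
      C' * (2 ^ (q * (1 + 3 * ε) / 2) / (1 - 2 ^ (q * (1 + 3 * ε) / 2 - 1))) ^ 2 * N *
        (∑ b ∈ range N, ‖f b‖ ^ q) ^ (2 / q) := by
  classical
  -- constants
  set c : ℝ := q * (1 + 3 * ε) with hc
  set A : ℝ := 2 ^ (c / 2) with hA
  set ρ : ℝ := 2 ^ (c / 2 - 1) with hρ
  have hq0 : 0 < q := by linarith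
  have hc0 : 0 < c := by rw [hc]; nlinarith
  have hρ0 : 0 < ρ := Real.rpow_pos_of_pos (by norm_num) _
  have hρ1 : ρ < 1 := Real.rpow_lt_one_of_one_lt_of_neg (by norm_num) (by rw [hc] at *; linarith)
  have hA0 : 0 < A := Real.rpow_pos_of_pos (by norm_num) _
  set K : ℝ := A / (1 - ρ) with hK
  have hK0 : 0 < K := div_pos hA0 (by linarith)
  have hβ' : ∀ n ∈ Icc 1 N, 0 ≤ β (n : ℕ) := hβ
  -- the quadratic form `Φ`
  set Φ : (ℕ → ℂ) → ℝ := fun h =>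
    ∑ n ∈ Icc 1 N, ‖∑ b ∈ range N, h b * e ((b : ℝ) * n / N)‖ ^ 2 * β n with hΦ
  have hΦ0 : ∀ h, 0 ≤ Φ h := fun h => Finset.sum_nonneg fun n hn =>
    mul_nonneg (sq_nonneg _) (hβ n hn)
  have hΦsmul : ∀ (t : ℝ) (h : ℕ → ℂ), Φ (fun b => (t : ℂ) * h b) = t ^ 2 * Φ h := by
    intro t h
    simp only [hΦ, Finset.mul_sum]
    refine Finset.sum_congr rfl fun n _ => ?_
    have : ∑ b ∈ range N, (t : ℂ) * h b * e ((b : ℝ) * n / N) =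
        (t : ℂ) * ∑ b ∈ range N, h b * e ((b : ℝ) * n / N) := by
      rw [Finset.mul_sum]; exact Finset.sum_congr rfl fun b _ => by ring
    rw [this, norm_mul, Complex.norm_real, Real.norm_eq_abs, mul_pow, sq_abs]; ring
  -- the claim for `‖g‖_q = 1`
  have key : ∀ g : ℕ → ℂ, ∑ b ∈ range N, ‖g b‖ ^ q = 1 → Φ g ≤ C' * K ^ 2 * N := by
    intro g hg1
    have hgle : ∀ b ∈ range N, ‖g b‖ ≤ 1 := by
      intro b hb
      by_contra hgt
      push Not at hgt
      have h1 : 1 < ‖g b‖ ^ q := Real.one_lt_rpow hgt hq0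
      have h2 : ‖g b‖ ^ q ≤ ∑ b ∈ range N, ‖g b‖ ^ q :=
        Finset.single_le_sum (fun b _ => Real.rpow_nonneg (norm_nonneg _) _) hb
      linarith
    -- the nonzero values and the depth `J`
    set V := ((range N).filter (fun b => g b ≠ 0)).image (fun b => ‖g b‖) with hV
    rcases V.eq_empty_or_nonempty with hVe | hVne
    · -- `g = 0` on `range N`
      have hg0 : ∀ b ∈ range N, g b = 0 := by
        intro b hb
        by_contra hne
        have : ‖g b‖ ∈ V := Finset.mem_image_of_mem _ (Finset.mem_filter.2 ⟨hb, hne⟩)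
        rw [hVe] at this
        exact Finset.notMem_empty _ this
      have : Φ g = 0 := by
        simp only [hΦ]
        refine Finset.sum_eq_zero fun n _ => ?_
        rw [Finset.sum_eq_zero fun b hb => by rw [hg0 b hb, zero_mul], norm_zero]
        ring
      rw [this]; positivity
    set m := V.min' hVne with hm
    have hm0 : 0 < m := by
      have := Finset.min'_mem V hVne
      rw [← hm, hV, Finset.mem_image] at this
      obtain ⟨b, hb, hbm⟩ := this
      rw [← hbm]
      exact norm_pos_iff.2 (Finset.mem_filter.1 hb).2
    obtain ⟨J, hJ⟩ := exists_pow_lt_of_lt_one hm0 (by norm_num : (2 : ℝ)⁻¹ < 1)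
    have hmle : ∀ b ∈ range N, g b ≠ 0 → m ≤ ‖g b‖ := fun b hb hne =>
      Finset.min'_le V _ (Finset.mem_image_of_mem _ (Finset.mem_filter.2 ⟨hb, hne⟩))
    -- the dyadic sets
    set Bj : ℕ → Finset ℕ := fun j => (range N).filter
      (fun b => (2 : ℝ)⁻¹ ^ (j + 1) < ‖g b‖ ∧ ‖g b‖ ≤ (2 : ℝ)⁻¹ ^ j) with hBj
    set gj : ℕ → ℕ → ℂ := fun j b => if b ∈ Bj j then g b else 0 with hgj
    have hBjsub : ∀ j, Bj j ⊆ range N := fun j => Finset.filter_subset _ _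
    -- decomposition `g = ∑_{j<J} g_j` on `range N`
    have hdecomp : ∀ b ∈ range N, g b = ∑ j ∈ range J, gj j b := by
      intro b hb
      by_cases hgb : g b = 0
      · rw [hgb]
        refine (Finset.sum_eq_zero fun j _ => ?_).symm
        rw [hgj]; simp only
        rw [if_neg]
        rw [hBj, Finset.mem_filter, hgb, norm_zero]
        intro h
        have := h.2.1
        have : (0 : ℝ) < (2 : ℝ)⁻¹ ^ (j + 1) := by positivity
        linarith
      · obtain ⟨j₀, hj₀J, hj₀l, hj₀u⟩ := exists_dyadic_index (hgle b hb)
          (hJ.trans_le (hmle b hb hgb))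
        have hmem : ∀ j, b ∈ Bj j ↔ ((2 : ℝ)⁻¹ ^ (j + 1) < ‖g b‖ ∧ ‖g b‖ ≤ (2 : ℝ)⁻¹ ^ j) := by
          intro j; rw [hBj, Finset.mem_filter]; exact ⟨fun h => h.2, fun h => ⟨hb, h⟩⟩
        have huniq : ∀ j, b ∈ Bj j → j = j₀ := by
          intro j hj
          rw [hmem] at hj
          by_contra hne
          rcases Nat.lt_or_gt_of_ne hne with hlt | hgt
          · have := inv_two_pow_le_of_le (show j + 1 ≤ j₀ by omega)
            linarith [hj.1]
          · have := inv_two_pow_le_of_le (show j₀ + 1 ≤ j by omega)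
            linarith [hj.2]
        have hfilt : (range J).filter (fun j => b ∈ Bj j) = {j₀} := by
          rw [Finset.eq_singleton_iff_unique_mem]
          refine ⟨Finset.mem_filter.2 ⟨Finset.mem_range.2 hj₀J, (hmem j₀).2 ⟨hj₀l, hj₀u⟩⟩, ?_⟩
          intro j hj
          exact huniq j (Finset.mem_filter.1 hj).2
        simp only [hgj]
        rw [← Finset.sum_filter, hfilt, Finset.sum_singleton]
    -- Minkowski
    have hmink : Real.sqrt (Φ g) ≤ ∑ j ∈ range J, Real.sqrt (Φ (gj j)) := by
      have h := sqrt_sum_norm_sum_sq_mul_le (Icc 1 N) (range J)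
        (fun j n => ∑ b ∈ range N, gj j b * e ((b : ℝ) * n / N)) (fun n => β n) hβ'
      refine le_trans (le_of_eq ?_) h
      simp only [hΦ]
      congr 1
      refine Finset.sum_congr rfl fun n _ => ?_
      congr 2
      rw [Finset.sum_comm]
      congr 1
      refine Finset.sum_congr rfl fun b hb => ?_
      rw [hdecomp b hb, Finset.sum_mul]
    -- the set estimate on each dyadic piece
    have hcardj : ∀ j, ((Bj j).card : ℝ) ≤ (2 : ℝ) ^ (((j : ℝ) + 1) * q) := by
      intro j
      have h1 : ((Bj j).card : ℝ) * ((2 : ℝ)⁻¹ ^ (j + 1)) ^ q ≤ 1 := by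
        calc ((Bj j).card : ℝ) * ((2 : ℝ)⁻¹ ^ (j + 1)) ^ q
            = ∑ b ∈ Bj j, ((2 : ℝ)⁻¹ ^ (j + 1)) ^ q := by rw [Finset.sum_const, nsmul_eq_mul]
          _ ≤ ∑ b ∈ Bj j, ‖g b‖ ^ q := by
              refine Finset.sum_le_sum fun b hb => ?_
              rw [hBj, Finset.mem_filter] at hb
              exact Real.rpow_le_rpow (by positivity) hb.2.1.le hq0.le
          _ ≤ ∑ b ∈ range N, ‖g b‖ ^ q :=
              Finset.sum_le_sum_of_subset_of_nonneg (hBjsub j) fun b _ _ =>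
                Real.rpow_nonneg (norm_nonneg _) _
          _ = 1 := hg1
      have h2 : (0 : ℝ) < ((2 : ℝ)⁻¹ ^ (j + 1)) ^ q := Real.rpow_pos_of_pos (by positivity) _
      rw [← le_div_iff₀ h2, one_div] at h1
      refine h1.trans (le_of_eq ?_)
      rw [inv_pow, Real.inv_rpow (by positivity), inv_inv, ← Real.rpow_natCast,
        ← Real.rpow_mul (by norm_num)]
      push_cast; ring_nf
    have hpiece : ∀ j, Φ (gj j) ≤ C' * N * (2 : ℝ) ^ (((j : ℝ) + 1) * c) / 4 ^ j := by
      intro j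
      have hs := hset (Bj j) (fun b => ((2 ^ j : ℝ) : ℂ) * gj j b) (hBjsub j) (by
        intro b
        rw [norm_mul, Complex.norm_real, Real.norm_eq_abs, abs_of_pos (by positivity), hgj]
        simp only
        split_ifs with hb
        · rw [hBj, Finset.mem_filter] at hb
          calc (2 : ℝ) ^ j * ‖g b‖ ≤ 2 ^ j * (2 : ℝ)⁻¹ ^ j :=
                mul_le_mul_of_nonneg_left hb.2.2 (by positivity)
            _ = 1 := by rw [← mul_pow]; norm_num
        · rw [norm_zero, mul_zero]; exact zero_le_one) (by
        intro b hb
        rw [hgj]; simp only; rw [if_neg hb, mul_zero])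
      have h4 : Φ (fun b => ((2 ^ j : ℝ) : ℂ) * gj j b) = 4 ^ j * Φ (gj j) := by
        rw [hΦsmul, ← pow_mul, mul_comm j 2, pow_mul]; norm_num
      have hs' : 4 ^ j * Φ (gj j) ≤ C' * N * ((Bj j).card : ℝ) ^ (1 + 3 * ε) := by
        rw [← h4]; exact hs
      have h5 : ((Bj j).card : ℝ) ^ (1 + 3 * ε) ≤ (2 : ℝ) ^ (((j : ℝ) + 1) * c) := by
        calc ((Bj j).card : ℝ) ^ (1 + 3 * ε) ≤ ((2 : ℝ) ^ (((j : ℝ) + 1) * q)) ^ (1 + 3 * ε) :=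
              Real.rpow_le_rpow (Nat.cast_nonneg _) (hcardj j) (by linarith)
          _ = (2 : ℝ) ^ (((j : ℝ) + 1) * c) := by
              rw [← Real.rpow_mul (by norm_num), hc]; congr 1; ring
      rw [le_div_iff₀ (by positivity)]
      calc Φ (gj j) * 4 ^ j = 4 ^ j * Φ (gj j) := mul_comm _ _
        _ ≤ C' * N * ((Bj j).card : ℝ) ^ (1 + 3 * ε) := hs'
        _ ≤ C' * N * (2 : ℝ) ^ (((j : ℝ) + 1) * c) :=
            mul_le_mul_of_nonneg_left h5 (by positivity)
    -- square roots
    have hsqrtpiece : ∀ j, Real.sqrt (Φ (gj j)) ≤ Real.sqrt (C' * N) * (A * ρ ^ j) := by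
      intro j
      have hpos : 0 ≤ Real.sqrt (C' * N) * (A * ρ ^ j) := by positivity
      rw [Real.sqrt_le_iff]
      refine ⟨hpos, (hpiece j).trans (le_of_eq ?_)⟩
      have h1 : A ^ 2 = (2 : ℝ) ^ c := by
        rw [hA, ← Real.rpow_natCast, ← Real.rpow_mul (by norm_num)]; congr 1; push_cast; ring
      have h2 : (ρ ^ j) ^ 2 = (2 : ℝ) ^ ((c - 2) * j) := by
        rw [hρ, ← Real.rpow_natCast, ← Real.rpow_natCast, ← Real.rpow_mul (by positivity),
          ← Real.rpow_mul (by norm_num)]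
        congr 1; push_cast; ring
      have h3 : (4 : ℝ) ^ j = (2 : ℝ) ^ ((2 : ℝ) * j) := by
        rw [Real.rpow_mul (by norm_num), Real.rpow_natCast, Real.rpow_two]; norm_num
      have h4pos : (0 : ℝ) < 4 ^ j := by positivity
      have hAρ : (A * ρ ^ j) ^ 2 = (2 : ℝ) ^ (((j : ℝ) + 1) * c) / 4 ^ j := by
        rw [eq_div_iff h4pos.ne', mul_pow, h1, h2, h3, ← Real.rpow_add (by norm_num),
          ← Real.rpow_add (by norm_num)]
        congr 1; ring
      rw [mul_pow, Real.sq_sqrt (by positivity), hAρ]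
      ring
    -- sum the geometric series
    have hgeom : ∑ j ∈ range J, ρ ^ j ≤ 1 / (1 - ρ) := by
      have := geom_sum_Ico_le_of_lt_one (x := ρ) (m := 0) (n := J) hρ0.le hρ1
      rwa [pow_zero, ← Finset.range_eq_Ico] at this
    have hsqrt : Real.sqrt (Φ g) ≤ Real.sqrt (C' * N) * K := by
      calc Real.sqrt (Φ g) ≤ ∑ j ∈ range J, Real.sqrt (Φ (gj j)) := hmink
        _ ≤ ∑ j ∈ range J, Real.sqrt (C' * N) * (A * ρ ^ j) := Finset.sum_le_sum fun j _ => hsqrtpiece j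
        _ = Real.sqrt (C' * N) * A * ∑ j ∈ range J, ρ ^ j := by
            rw [Finset.mul_sum]; exact Finset.sum_congr rfl fun j _ => by ring
        _ ≤ Real.sqrt (C' * N) * A * (1 / (1 - ρ)) :=
            mul_le_mul_of_nonneg_left hgeom (by positivity)
        _ = Real.sqrt (C' * N) * K := by rw [hK]; ring
    calc Φ g = Real.sqrt (Φ g) ^ 2 := (Real.sq_sqrt (hΦ0 g)).symm
      _ ≤ (Real.sqrt (C' * N) * K) ^ 2 := pow_le_pow_left₀ (Real.sqrt_nonneg _) hsqrt 2
      _ = C' * K ^ 2 * N := by rw [mul_pow, Real.sq_sqrt (by positivity)]; ring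
  -- homogeneity
  set S : ℝ := ∑ b ∈ range N, ‖f b‖ ^ q with hS
  have hS0 : 0 ≤ S := Finset.sum_nonneg fun b _ => Real.rpow_nonneg (norm_nonneg _) _
  rcases hS0.eq_or_lt with hS00 | hSpos
  · -- `f = 0` on `range N`
    have hf0 : ∀ b ∈ range N, f b = 0 := by
      intro b hb
      have h := (Finset.sum_eq_zero_iff_of_nonneg (fun b _ => Real.rpow_nonneg (norm_nonneg _) q)).1
        hS00.symm b hb
      rw [Real.rpow_eq_zero_iff_of_nonneg (norm_nonneg _)] at h
      exact norm_eq_zero.1 h.1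
    have : Φ f = 0 := by
      simp only [hΦ]
      refine Finset.sum_eq_zero fun n _ => ?_
      rw [Finset.sum_eq_zero fun b hb => by rw [hf0 b hb, zero_mul], norm_zero]
      ring
    change Φ f ≤ _
    rw [this]
    exact mul_nonneg (by positivity) (Real.rpow_nonneg hS0 _)
  · set F : ℝ := S ^ (1 / q) with hF
    have hF0 : 0 < F := Real.rpow_pos_of_pos hSpos _
    have hFq : F ^ q = S := by
      rw [hF, ← Real.rpow_mul hS0, one_div, inv_mul_cancel₀ hq0.ne', Real.rpow_one]
    have hF2 : F ^ 2 = S ^ (2 / q) := by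
      rw [hF, ← Real.rpow_natCast, ← Real.rpow_mul hS0]; congr 1; push_cast; ring
    set g : ℕ → ℂ := fun b => ((F⁻¹ : ℝ) : ℂ) * f b with hg
    have hg1 : ∑ b ∈ range N, ‖g b‖ ^ q = 1 := by
      have : ∀ b, ‖g b‖ ^ q = ‖f b‖ ^ q / F ^ q := by
        intro b
        rw [hg]; simp only
        rw [norm_mul, Complex.norm_real, Real.norm_eq_abs, abs_of_pos (inv_pos.2 hF0), mul_comm,
          ← div_eq_mul_inv, Real.div_rpow (norm_nonneg _) hF0.le]
      simp_rw [this]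
      rw [← Finset.sum_div, hFq, ← hS, div_self hSpos.ne']
    have hfg : f = fun b => (F : ℂ) * g b := by
      funext b
      rw [hg]; simp only
      rw [← mul_assoc, ← Complex.ofReal_mul, mul_inv_cancel₀ hF0.ne', Complex.ofReal_one, one_mul]
    have hΦf : Φ f = F ^ 2 * Φ g := by
      conv_lhs => rw [hfg]
      exact hΦsmul F g
    change Φ f ≤ _
    rw [hΦf, hF2]
    have := key g hg1
    calc S ^ (2 / q) * Φ g ≤ S ^ (2 / q) * (C' * K ^ 2 * N) :=
          mul_le_mul_of_nonneg_left this (Real.rpow_nonneg hS0 _)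
      _ = C' * K ^ 2 * N * S ^ (2 / q) := by ring


/-! ### Duality: from the restriction estimate to the extension estimate on `ℤ/Nℤ` -/

/-- **Duality** (GT, proof of Prop. 4.2, (4.7) from (4.1)): if
`∑_{n=1}^{N} |f̂(n)|² β(n) ≤ C_R N ‖f‖_{ℓ^q}²` for all `f`, then for every sequence `a`,
`(∑_{b<N} |N⁻¹ ∑_{n=1}^{N} a_n β(n) e(bn/N)|^p)^{1/p} ≤ √C_R (N⁻¹ ∑_n |a_n|² β(n))^{1/2}`,
where `(p-1) q = p` (dual exponents). Proof: test against `f_b = |x_b|^{p-2} \bar x_b`.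
[cite: GreenTao2006Restriction, Prop. 4.2, proof of (4.7)] -/
theorem extension_of_restriction {N : ℕ} (hN : 0 < N) (β : ℤ → ℝ)
    (hβ : ∀ n ∈ Icc 1 N, 0 ≤ β n) {CR p q : ℝ} (hCR : 0 ≤ CR) (hp : 1 < p) (hq : 0 < q)
    (hpq : (p - 1) * q = p)
    (hres : ∀ f : ℕ → ℂ, ∑ n ∈ Icc 1 N, ‖∑ b ∈ range N, f b * e ((b : ℝ) * n / N)‖ ^ 2 * β n ≤
      CR * N * (∑ b ∈ range N, ‖f b‖ ^ q) ^ (2 / q))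
    (a : ℕ → ℂ) :
    (∑ b ∈ range N, ‖(N : ℂ)⁻¹ * ∑ n ∈ Icc 1 N, a n * β n * e ((b : ℝ) * n / N)‖ ^ p) ^ (1 / p) ≤
      Real.sqrt CR * Real.sqrt ((N : ℝ)⁻¹ * ∑ n ∈ Icc 1 N, ‖a n‖ ^ 2 * β n) := by
  have hN0 : (0 : ℝ) < N := by exact_mod_cast hN
  have hp0 : 0 < p := by linarith
  have hβ' : ∀ n ∈ Icc 1 N, 0 ≤ β (n : ℕ) := hβ
  set x : ℕ → ℂ := fun b => (N : ℂ)⁻¹ * ∑ n ∈ Icc 1 N, a n * β n * e ((b : ℝ) * n / N) with hx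
  set X : ℝ := ∑ b ∈ range N, ‖x b‖ ^ p with hX
  have hX0 : 0 ≤ X := Finset.sum_nonneg fun b _ => Real.rpow_nonneg (norm_nonneg _) _
  set Sa : ℝ := ∑ n ∈ Icc 1 N, ‖a n‖ ^ 2 * β n with hSa
  have hSa0 : 0 ≤ Sa := Finset.sum_nonneg fun n hn => mul_nonneg (sq_nonneg _) (hβ n hn)
  change X ^ (1 / p) ≤ _
  rcases hX0.eq_or_lt with hX00 | hXpos
  · rw [← hX00, Real.zero_rpow (by positivity)]; positivity
  -- the test function
  set f : ℕ → ℂ := fun b => ((‖x b‖ ^ (p - 2) : ℝ) : ℂ) * conj (x b) with hf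
  have hfx : ∀ b, f b * x b = ((‖x b‖ ^ p : ℝ) : ℂ) := by
    intro b
    rw [hf]; simp only
    rw [mul_assoc, Complex.conj_mul', ← Complex.ofReal_pow, ← Complex.ofReal_mul]
    congr 1
    rcases (norm_nonneg (x b)).eq_or_lt with h0 | hpos
    · rw [← h0, zero_pow two_ne_zero, mul_zero, Real.zero_rpow hp0.ne']
    · rw [← Real.rpow_natCast, ← Real.rpow_add hpos]; congr 1; push_cast; ring
  have hfnorm : ∀ b, ‖f b‖ = ‖x b‖ ^ (p - 1) := by
    intro b
    rw [hf]; simp only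
    rw [norm_mul, Complex.norm_real, Real.norm_eq_abs, Complex.norm_conj,
      abs_of_nonneg (Real.rpow_nonneg (norm_nonneg _) _)]
    rcases (norm_nonneg (x b)).eq_or_lt with h0 | hpos
    · rw [← h0, mul_zero, Real.zero_rpow (by linarith)]
    · rw [← Real.rpow_add_one hpos.ne']; congr 1; ring
  have hfq : ∑ b ∈ range N, ‖f b‖ ^ q = X := by
    refine Finset.sum_congr rfl fun b _ => ?_
    rw [hfnorm, ← Real.rpow_mul (norm_nonneg _), hpq]
  -- `X = N⁻¹ ∑_n a_n β_n \hat f(n)`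
  have hXeq : (X : ℂ) = (N : ℂ)⁻¹ * ∑ n ∈ Icc 1 N,
      a n * β n * ∑ b ∈ range N, f b * e ((b : ℝ) * n / N) := by
    have h1 : (X : ℂ) = ∑ b ∈ range N, f b * x b := by
      rw [hX]; push_cast; exact Finset.sum_congr rfl fun b _ => (hfx b).symm
    rw [h1, Finset.mul_sum]
    simp only [hx, Finset.mul_sum]
    rw [Finset.sum_comm]
    exact Finset.sum_congr rfl fun n _ => Finset.sum_congr rfl fun b _ => by ring
  -- Cauchy–Schwarz and the restriction estimate
  have hinner : ‖∑ n ∈ Icc 1 N, a n * β n * ∑ b ∈ range N, f b * e ((b : ℝ) * n / N)‖ ≤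
      Real.sqrt Sa * Real.sqrt (CR * N * X ^ (2 / q)) := by
    calc ‖∑ n ∈ Icc 1 N, a n * β n * ∑ b ∈ range N, f b * e ((b : ℝ) * n / N)‖
        ≤ ∑ n ∈ Icc 1 N, ‖a n‖ * β n * ‖∑ b ∈ range N, f b * e ((b : ℝ) * n / N)‖ := by
          refine (norm_sum_le _ _).trans (le_of_eq (Finset.sum_congr rfl fun n hn => ?_))
          rw [norm_mul, norm_mul, Complex.norm_real, Real.norm_eq_abs, abs_of_nonneg (hβ n hn)]
      _ ≤ Real.sqrt Sa *
            Real.sqrt (∑ n ∈ Icc 1 N, ‖∑ b ∈ range N, f b * e ((b : ℝ) * n / N)‖ ^ 2 * β n) :=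
          sum_mul_mul_le_sqrt_mul_sqrt (Icc 1 N) a _ (fun n => β n) hβ'
      _ ≤ Real.sqrt Sa * Real.sqrt (CR * N * X ^ (2 / q)) := by
          refine mul_le_mul_of_nonneg_left (Real.sqrt_le_sqrt ?_) (Real.sqrt_nonneg _)
          rw [← hfq]; exact hres f
  have hXle : X ≤ (N : ℝ)⁻¹ * (Real.sqrt Sa * Real.sqrt (CR * N * X ^ (2 / q))) := by
    have h1 : X = ‖(X : ℂ)‖ := by rw [Complex.norm_real, Real.norm_eq_abs, abs_of_nonneg hX0]
    have h2 : ‖(X : ℂ)‖ = (N : ℝ)⁻¹ *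
        ‖∑ n ∈ Icc 1 N, a n * β n * ∑ b ∈ range N, f b * e ((b : ℝ) * n / N)‖ := by
      rw [hXeq, norm_mul, norm_inv, Complex.norm_natCast]
    calc X = ‖(X : ℂ)‖ := h1
      _ = _ := h2
      _ ≤ _ := mul_le_mul_of_nonneg_left hinner (by positivity)
  -- solve for `X^{1/p}`
  have hsq : Real.sqrt (CR * N * X ^ (2 / q)) = Real.sqrt CR * Real.sqrt N * X ^ (1 / q) := by
    rw [Real.sqrt_mul' _ (Real.rpow_nonneg hX0 _), Real.sqrt_mul hCR, Real.sqrt_eq_rpow (X ^ (2 / q)),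
      ← Real.rpow_mul hX0]
    congr 2; ring
  rw [hsq] at hXle
  have hq1 : 1 / p = 1 - 1 / q := by
    have hp1 : p - 1 ≠ 0 := by linarith
    field_simp
    nlinarith [hpq]
  have hXq : 0 < X ^ (1 / q) := Real.rpow_pos_of_pos hXpos _
  rw [hq1, Real.rpow_sub hXpos, Real.rpow_one, div_le_iff₀ hXq]
  calc X ≤ (N : ℝ)⁻¹ * (Real.sqrt Sa * (Real.sqrt CR * Real.sqrt N * X ^ (1 / q))) := hXle
    _ = Real.sqrt CR * (Real.sqrt N * (N : ℝ)⁻¹ * Real.sqrt Sa) * X ^ (1 / q) := by ring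
    _ = Real.sqrt CR * Real.sqrt ((N : ℝ)⁻¹ * Sa) * X ^ (1 / q) := by
        congr 2
        rw [Real.sqrt_mul (by positivity), Real.sqrt_inv]
        have hsN : Real.sqrt N ≠ 0 := (Real.sqrt_pos.2 hN0).ne'
        have : (N : ℝ)⁻¹ = (Real.sqrt N)⁻¹ * (Real.sqrt N)⁻¹ := by
          rw [← mul_inv, Real.mul_self_sqrt hN0.le]
        rw [this]; field_simp

/-! ### Integration: from `ℤ/Nℤ` to `L^p(𝕋)` -/

/-- `e(t) = exp(2π i t)` in the form used by the named fact. [folklore] -/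
theorem exp_two_pi_mul_eq_e (n : ℕ) (t : ℝ) :
    Complex.exp (2 * Real.pi * Complex.I * (n : ℂ) * (t : ℂ)) = e ((n : ℝ) * t) := by
  rw [e_eq_exp]; congr 1; push_cast; ring

/-- **From `ℤ/Nℤ` to the circle** (GT, proof of Prop. 4.2, (4.8) from (4.7)): an extension
bound on `ℤ/Nℤ` that is uniform under modulation of the coefficients integrates to the
`L^p(𝕋)` bound with the factor `N^{-1/p}`:
`(∫₀¹ |N⁻¹ ∑_n u_n β(n) e(nθ)|^p dθ)^{1/p} ≤ C N^{-1/p} (N⁻¹ ∑ |u_n|² β(n))^{1/2}`.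
[cite: GreenTao2006Restriction, Prop. 4.2, proof of (4.8)] -/
theorem Lp_extension_of_extension {N : ℕ} (hN : 0 < N) (β : ℤ → ℝ) {C p : ℝ} (hC : 0 ≤ C)
    (hp : 0 < p)
    (hext : ∀ a : ℕ → ℂ,
      (∑ b ∈ range N, ‖(N : ℂ)⁻¹ * ∑ n ∈ Icc 1 N, a n * β n * e ((b : ℝ) * n / N)‖ ^ p) ^ (1 / p) ≤
        C * Real.sqrt ((N : ℝ)⁻¹ * ∑ n ∈ Icc 1 N, ‖a n‖ ^ 2 * β n))
    (u : ℕ → ℂ) :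
    (∫ θ in (0 : ℝ)..1, ‖(N : ℂ)⁻¹ * ∑ n ∈ Finset.Icc 1 N,
        u n * (β n : ℂ) * Complex.exp (2 * Real.pi * Complex.I * (n : ℂ) * (θ : ℂ))‖ ^ p) ^ (1 / p) ≤
      C * (N : ℝ) ^ (-(1 / p)) *
        ((N : ℝ)⁻¹ * ∑ n ∈ Finset.Icc 1 N, ‖u n‖ ^ 2 * β n) ^ (1 / 2 : ℝ) := by
  have hN0 : (0 : ℝ) < N := by exact_mod_cast hN
  have hNne : (N : ℝ) ≠ 0 := hN0.ne'
  -- the function on the circle and its `p`-th power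
  set g : ℝ → ℂ := fun θ => (N : ℂ)⁻¹ * ∑ n ∈ Finset.Icc 1 N,
    u n * (β n : ℂ) * Complex.exp (2 * Real.pi * Complex.I * (n : ℂ) * (θ : ℂ)) with hg
  set h : ℝ → ℝ := fun θ => ‖g θ‖ ^ p with hh
  have hgcont : Continuous g := by
    rw [hg]
    refine continuous_const.mul (continuous_finsetSum _ fun n _ => ?_)
    exact continuous_const.mul (Complex.continuous_exp.comp (continuous_const.mul
      Complex.continuous_ofReal))
  have hhcont : Continuous h := by
    rw [hh]
    exact (continuous_norm.comp hgcont).rpow_const fun _ => Or.inr hp.le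
  have hh0 : ∀ θ, 0 ≤ h θ := fun θ => Real.rpow_nonneg (norm_nonneg _) _
  set Su : ℝ := (N : ℝ)⁻¹ * ∑ n ∈ Finset.Icc 1 N, ‖u n‖ ^ 2 * β n with hSu
  set Kp : ℝ := (C * Real.sqrt Su) ^ p with hKp
  -- the uniform bound from the extension estimate with modulated coefficients
  have hmod : ∀ θ : ℝ, ∑ b ∈ range N, h (θ / N + b / N) ≤ Kp := by
    intro θ
    set a : ℕ → ℂ := fun n => u n * e ((n : ℝ) * θ / N) with ha
    have hxa : ∀ b : ℕ, (N : ℂ)⁻¹ * ∑ n ∈ Icc 1 N, a n * β n * e ((b : ℝ) * n / N) =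
        g (θ / N + b / N) := by
      intro b
      rw [hg]; simp only
      congr 1
      refine Finset.sum_congr rfl fun n _ => ?_
      rw [ha]; simp only
      rw [exp_two_pi_mul_eq_e, mul_assoc (u n), mul_comm (e _), ← mul_assoc, mul_assoc, ← e_add]
      congr 2; ring
    have haS : (N : ℝ)⁻¹ * ∑ n ∈ Icc 1 N, ‖a n‖ ^ 2 * β n = Su := by
      rw [hSu]; congr 1
      refine Finset.sum_congr rfl fun n _ => ?_
      rw [ha]; simp only; rw [norm_mul, norm_e, mul_one]
    have h1 := hext a
    simp_rw [hxa] at h1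
    rw [haS] at h1
    have h2 : 0 ≤ ∑ b ∈ range N, ‖g (θ / N + b / N)‖ ^ p :=
      Finset.sum_nonneg fun b _ => Real.rpow_nonneg (norm_nonneg _) _
    have h3 := Real.rpow_le_rpow (Real.rpow_nonneg h2 _) h1 hp.le
    rw [← Real.rpow_mul h2, one_div, inv_mul_cancel₀ hp.ne', Real.rpow_one] at h3
    exact h3
  -- decompose `[0,1]` into the intervals `[b/N, (b+1)/N]`
  have hsplit : ∫ θ in (0 : ℝ)..1, h θ = ∑ b ∈ range N, ∫ θ in ((b : ℝ) / N)..(((b + 1 : ℕ) : ℝ) / N), h θ := by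
    have := intervalIntegral.sum_integral_adjacent_intervals (μ := volume) (f := h)
      (a := fun k : ℕ => (k : ℝ) / N) (n := N) (fun k _ => hhcont.intervalIntegrable _ _)
    simp only [Nat.cast_zero, zero_div, div_self hNne] at this
    rw [← this]
  have hpiece : ∀ b : ℕ, ∫ θ in ((b : ℝ) / N)..(((b + 1 : ℕ) : ℝ) / N), h θ =
      (N : ℝ)⁻¹ * ∫ θ in (0 : ℝ)..1, h (θ / N + b / N) := by
    intro b
    have := intervalIntegral.integral_comp_div_add h hNne ((b : ℝ) / N) (a := 0) (b := 1)
    rw [zero_div, zero_add, show (1 : ℝ) / N + b / N = ((b + 1 : ℕ) : ℝ) / N by push_cast; ring] at this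
    rw [this, smul_eq_mul, ← mul_assoc, inv_mul_cancel₀ hNne, one_mul]
  have hshift : ∀ b : ℕ, Continuous fun θ : ℝ => h (θ / N + b / N) := fun b =>
    hhcont.comp ((continuous_id.div_const _).add continuous_const)
  have hint : ∫ θ in (0 : ℝ)..1, h θ ≤ (N : ℝ)⁻¹ * Kp := by
    rw [hsplit, Finset.sum_congr rfl fun b _ => hpiece b, ← Finset.mul_sum,
      ← intervalIntegral.integral_finsetSum fun b _ => (hshift b).intervalIntegrable _ _]
    refine mul_le_mul_of_nonneg_left ?_ (by positivity)
    calc ∫ θ in (0 : ℝ)..1, ∑ b ∈ range N, h (θ / N + b / N) ≤ ∫ _ in (0 : ℝ)..1, Kp := by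
          refine intervalIntegral.integral_mono_on zero_le_one ?_ ?_ fun θ _ => hmod θ
          · exact (continuous_finsetSum _ fun b _ => hshift b).intervalIntegrable _ _
          · exact intervalIntegrable_const
      _ = Kp := by rw [intervalIntegral.integral_const, sub_zero, one_smul]
  -- take `p`-th roots
  have hint0 : 0 ≤ ∫ θ in (0 : ℝ)..1, h θ :=
    intervalIntegral.integral_nonneg zero_le_one fun θ _ => hh0 θ
  have hKp0 : 0 ≤ Kp := by rw [hKp]; positivity
  change (∫ θ in (0 : ℝ)..1, h θ) ^ (1 / p) ≤ _
  calc (∫ θ in (0 : ℝ)..1, h θ) ^ (1 / p) ≤ ((N : ℝ)⁻¹ * Kp) ^ (1 / p) :=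
        Real.rpow_le_rpow hint0 hint (by positivity)
    _ = C * (N : ℝ) ^ (-(1 / p)) * Su ^ (1 / 2 : ℝ) := by
        rw [Real.mul_rpow (by positivity) hKp0, hKp, ← Real.rpow_mul (by positivity),
          mul_one_div_cancel hp.ne', Real.rpow_one, Real.inv_rpow hN0.le, ← Real.rpow_neg hN0.le,
          Real.sqrt_eq_rpow]
        ring

end GreenTao2006

end Literature.NumberTheory.Sieve
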